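import Summits.AtomisticToContinuum.BoseEinsteinCondensation.Theorems.CorrectorClosure.Negative.InsertionResidueUniformWindowFalse

/-!
# Negative lemmas for crux `CorrectorClosure` (stmt-AtomisticToContinuum-12058), IV:
the constant `c` of `InsertionResidue` — no `c > 1`, and `c = 1` is attained

Supports stmt-AtomisticToContinuum-12058 (route `BECInsertionCorrector`).
`not_insertionResidueConst_of_one_lt`: the target with a FIXED constant `c > 1` is false (already
at `v = 0`: the constant state is a near-minimiser and the Cauchy–Schwarz bound of file II-c caps
the quantity at `1`). `overlap_sq_const_const`: the cap is ATTAINED — inserting a zero-momentum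
particle into the constant `N`-state gives the constant `(N+1)`-state exactly,
`L⁻³|⟨φ₀ ⊗ Θ₀, Ψ₀⟩|² = 1` for every `N`, `L > 0` (free gas: insertion residue `1`).
-/

noncomputable section

open MeasureTheory Filter Metric WithLp
open scoped ENNReal NNReal ComplexConjugate BigOperators

namespace Summit.AtomisticToContinuum.BoseEinsteinCondensation.Theorems.CorrectorClosure.Negative

open Literature.MathematicalPhysics.QuantumManyBody.BoseGas
open Summit.AtomisticToContinuum.BoseEinsteinCondensation.Theses.BECInsertionCorrector

/-! ## §8 The constant `c`: no target with `c > 1`, and `c = 1` is attained by the free gas -/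

/-- `InsertionResidue` with a FIXED constant `c` in place of `∃ c > 0` (everything else verbatim). -/
def InsertionResidueConst (c : ℝ) : Prop :=
  ∀ v : ℝ → ENNReal, IsRepulsiveFiniteRange v → ∃ ρ₀ : ℝ, 0 < ρ₀ ∧ ∀ ρ : ℝ, 0 < ρ → ρ < ρ₀ →
    ∀ᶠ N : ℕ in Filter.atTop, ∃ δ : ENNReal, 0 < δ ∧
      ∃ Θ : PeriodicTrialState N (sideLength ρ (N + 1)),
        periodicEnergy v Θ ≤ periodicGroundStateEnergy v N (sideLength ρ (N + 1)) + δ ∧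
        ∀ Ψ : PeriodicTrialState (N + 1) (sideLength ρ (N + 1)),
          periodicEnergy v Ψ ≤ periodicGroundStateEnergy v (N + 1) (sideLength ρ (N + 1)) + δ →
          ENNReal.ofReal c ≤ ENNReal.ofReal ((sideLength ρ (N + 1) ^ 3)⁻¹) *
            (‖∫ X in cellN N (sideLength ρ (N + 1)), conj (Θ.ψ X) *
                ∫ x in cell (sideLength ρ (N + 1)), Ψ.ψ (Matrix.vecCons x X)‖₊ : ENNReal) ^ 2

/-- The constant state (`b = 0`) has zero free energy. [folklore] -/
theorem periodicEnergy_zero_affineState_const {M : ℕ} {L : ℝ} (hL : 0 < L) (hM : 0 < M)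
    {n : Fin 3 → ℤ} (hn : n ≠ 0) {a : ℂ} (hab : a ≠ 0 ∨ (0 : ℂ) ≠ 0) :
    periodicEnergy 0 (affineState hL hM hn hab) = 0 := by
  unfold affineState
  rw [periodicEnergy_zero_ofFun]
  simp_rw [kineticDensity_affine]
  simp

/-- **No insertion residue above `1`.** For every `c > 1` the fixed-constant target is false
(already for `v = 0`: the constant state is a near-minimiser and §5 bounds the quantity by `1`).
[folklore] -/
theorem not_insertionResidueConst_of_one_lt {c : ℝ} (hc : 1 < c) : ¬ InsertionResidueConst c := by
  intro h
  obtain ⟨ρ₀, hρ₀, h⟩ := h 0 isRepulsiveFiniteRange_zero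
  have hρ : (0 : ℝ) < ρ₀ / 2 := by positivity
  obtain ⟨N, δ, _hδ, Θ, _hΘ, H⟩ := (h (ρ₀ / 2) hρ (by linarith)).exists
  have hL := sideLength_succ_pos hρ N
  have hab : (1 : ℂ) ≠ 0 ∨ (0 : ℂ) ≠ 0 := Or.inl one_ne_zero
  have hwin : periodicEnergy 0 (affineState (M := N + 1) hL (Nat.succ_pos N) e0_ne_zero hab) ≤
      periodicGroundStateEnergy 0 (N + 1) (sideLength (ρ₀ / 2) (N + 1)) + δ := by
    rw [periodicEnergy_zero_affineState_const hL (Nat.succ_pos N) e0_ne_zero hab]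
    exact zero_le
  have h1 := (H _ hwin).trans (overlap_sq_le_one hL Θ _)
  rw [ENNReal.ofReal_le_one] at h1
  linarith

/-- `e_0 = 1` for the plane waves of §2. [folklore] -/
theorem pw_k_zero (L : ℝ) (x : Space) : pw L 0 x = 1 := by
  simp [pw, phase]

/-- The constant product state is the constant `L^{-3N/2}`. [folklore] -/
theorem planeWave_zero_ψ (N : ℕ) {L : ℝ} (hL : 0 < L) (X : Config N) :
    (planeWave N hL 0).ψ X = (normConst N L : ℂ) := by
  rw [planeWave_ψ, Finset.prod_eq_one (fun j _ => pw_k_zero L (X j)), mul_one]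

/-- **`c = 1` is attained**: inserting a zero-momentum particle into the free `N`-body ground state
(the constant) gives exactly the free `(N+1)`-body ground state: `L⁻³ |⟨φ₀ ⊗ Θ₀, Ψ₀⟩|² = 1`.
So the Cauchy–Schwarz bound of §5 is sharp and the free gas has insertion residue `1`. [folklore] -/
theorem overlap_sq_const_const (N : ℕ) {L : ℝ} (hL : 0 < L) :
    ENNReal.ofReal ((L ^ 3)⁻¹) *
      (‖∫ X in cellN N L, conj ((planeWave N hL 0).ψ X) *
          ∫ x in cell L, (planeWave (N + 1) hL 0).ψ (Matrix.vecCons x X)‖₊ : ℝ≥0∞) ^ 2 = 1 := by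
  have hL3 : 0 < L ^ 3 := by positivity
  set s : ℝ := Real.sqrt (L ^ 3) with hs
  have hs0 : 0 < s := Real.sqrt_pos.2 hL3
  have hs2 : s ^ 2 = L ^ 3 := Real.sq_sqrt hL3.le
  simp_rw [planeWave_zero_ψ]
  rw [setIntegral_cell_const hL.le, Complex.conj_ofReal, setIntegral_cellN_const hL.le]
  -- the overlap is the real number r = (L³)^N L^{-3N/2} L³ L^{-3(N+1)/2} = √(L³)
  have hr : ((((L ^ 3) ^ N : ℝ) : ℂ) * ((normConst N L : ℂ) * (((L ^ 3 : ℝ) : ℂ) *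
      (normConst (N + 1) L : ℂ)))) = (s : ℂ) := by
    have hreal : (L ^ 3) ^ N * (normConst N L * (L ^ 3 * normConst (N + 1) L)) = s := by
      unfold normConst
      rw [← hs, ← hs2, inv_pow, inv_pow]
      field_simp
      ring
    exact_mod_cast hreal
  rw [hr, coe_nnnorm_sq_eq_ofReal, Complex.norm_real, Real.norm_of_nonneg hs0.le, hs2,
    ← ENNReal.ofReal_mul (inv_nonneg.2 hL3.le), inv_mul_cancel₀ hL3.ne', ENNReal.ofReal_one]



end Summit.AtomisticToContinuum.BoseEinsteinCondensation.Theorems.CorrectorClosure.Negative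

end
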